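import Summits.ABC.IUTFork.Joshi.TestGenuinePinsVacuitySqrt
import Summits.ABC.IUTFork.Joshi.TestGenuinePinsVacuityQuadraticField
import HarnessLib

/-!
# Branch E TEST — the genuine-carrier pins are UNSATISFIABLE over EVERY number field containing `√3` (any degree), hence over
# EVERY number field with a quadratic subfield (R-J row Y-26, residual ask P1′)

Proof-only sequel (abc-iut cell, D-0079 R-J «Joshi Y-discharge census», row Y-26 residual class; seat abc-iut-E-t43, gen 5; 0 definitions,
no `Prop` fact, FACT rows used: none) to this lineage's `Joshi/TestGenuinePinsVacuitySqrt.lean` (p462506) and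
`Joshi/TestGenuinePinsVacuityQuadraticField.lean` (p461949), answering the second adversary lane's residual ask P1′ (abc-iut-E-cx-2,
2026-08-26 19:49:15Z): «drop `hd3 : d ≠ 3` from `…_of_sq_eq_squarefree`».  The g4 lemma
`GenuinePinsResidual.closedBall_one_ne_zpow_smul_logUnits_of_sq_eq_three` used `[F : ℚ] = 2` ONLY to force `(e, f) = (2, 1)` at the place
over `3`; the rest of its argument is local.  Here the local core is isolated and the global degree hypothesis disappears:

* `GenuinePinsResidual.torsionPExp_eq_zero_of_sq_eq_three` (§1, classical local algebra) — a `ℚ_3`-field of residue degree `1` containing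
  `ρ` with `ρ² = 3` has NO non-trivial `3`-power roots of unity (`ζ_3` and `ρ` would give `√−1 = (2ζ_3 + 1)ρ/3`, excluded at residue degree
  `1` by p461297's `not_sq_eq_neg_one_three`);
* **`not_pinnedRegions(3)_settingPrVolSharp_of_sq_eq_three`** (§2) — EVERY number field `F ∋ s` with `s² = 3`, ANY degree: at any place
  `v₀ ∣ 3` one has `e(v₀|3) ≥ 2` (`‖s‖ = 3^{−1/2}`, p461297's `two_le_ramificationIdx_of_sq_eq_of_dvd`); if `f(v₀|3) = 1`, §1 and p461298's
  torsion-free ramified feed `…_of_torsionPExp_eq_zero_anyPrime`; if `f(v₀|3) ≥ 2`, `(e, f) ≠ (2, 1)` and p461298's `…_of_three_anyPrime`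
  (abc-iut-w5-d039's mover) — so the case p462506 left open («`F ∋ √3` of degree `> 2`, `ℚ_2(√3)`-shaped dyadic places, `ζ_3` at every
  `v ∣ 3`») is EMPTY: `ζ_3` and `√3` never meet at residue degree `1`, and residue degree `≥ 2` is moved;
* **`not_pinnedRegions(3)_settingPrVolSharp_of_sq_eq_squarefree'`** (§3) — p462506's theorem WITHOUT `hd3`: EVERY number field `F ∋ √d`,
  `d` squarefree, `d ≠ 1`, any degree, no `√−1`, no initial Θ-datum;
* **`not_pinnedRegions(3)_settingPrVolSharp_of_sq_eq_of_not_isSquare`** (§3) — the same from `s² = d ∈ ℤ`, `d` not a square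
  (`d = b²·a`, `a` squarefree `≠ 1`);
* **`not_pinnedRegions(3)_settingPrVolSharp_of_intermediateField_finrank_eq_two`** (§4) — EVERY number field with a QUADRATIC SUBFIELD
  `K ≤ F` (`K = ℚ(√d_K)` by the tree's `Quadratic.exists_sq_eq_discr` / `…isFundamentalDiscriminant_discr`; then §3 — the degree of `F`
  never enters).

Each result is a `¬ Cor312Vol.PinnedRegions` (/ `¬ PinnedRegions3`) theorem at abc-iut-c312-7's `settingPrVolSharp` over
`LatticeSituation.ofShells (logShellsDH X (analyticLogv F)) …`, analytic logarithms, EVERY `X : PilotData F`, `ρ`, `qK`, column data, `Ψ`,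
ideles, column; all movers / feeds consumed BY NAME.  CONSEQUENCE FOR THE RECORD (tree currency, no side taken): the first clause of the
second lane's proposed Y-26 residual word — «pins KERNEL-EMPTY for every `F` with a quadratic subfield» — now holds with NO exception.
WHAT STAYS ON PAPER: «`F ≠ ℚ` WITHOUT a quadratic subfield ⇒ some completion is moved» (root-discriminant `≤ 2√3` enumeration).
HONEST SCOPE: OUR interface, OUR sharp real container, Dupuy–Hilado's reading of (Ind2); nothing here bears on print's (xi-e)/(xi-f);
locates / conditionally verifies; no abc claim. [claim: Mochizuki2012, status: disputed] [cite: DupuyHilado2025, §4.9]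
[cite: NeukirchANT1999, Ch. II Prop. (5.3), (5.7), (6.8)]
-/

noncomputable section

open Set Function NumberField IsDedekindDomain Metric
open scoped Pointwise

namespace Summit.ABC.IUTFork.Joshi

open Thm311 Thm311.Real Cor312 Cor312Vol Literature.IUT.LogThetaLattice Literature.IUT.LogVolume
  Literature.IUT.HodgeTheaters Literature.NumberTheory.NumberFields
open Literature.NumberTheory.GaloisRepresentations.Ultrametric
open Literature.NumberTheory.QuadraticFields

/-! ## 1. Local: `√3` at residue degree one kills the `3`-power roots of unity -/

namespace GenuinePinsResidual

section LocalField

variable (K : Type*) [NontriviallyNormedField K] [NormedAlgebra ℚ_[3] K] [IsUltrametricDist K] [ProperSpace K]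

/-- **A `ℚ_3`-field of residue degree `1` containing `ρ` with `ρ² = 3` has `torsionPExp 3 K = 0`** (no `ζ_3`: with a primitive cube
root `μ`, `u = (2μ + 1)ρ/3` satisfies `u² = −1`, impossible at residue degree `1` over `ℚ_3` — p461297's `not_sq_eq_neg_one_three`).
This is the local core of p461297's `closedBall_one_ne_zpow_smul_logUnits_of_sq_eq_three`, with its global degree hypothesis removed.
[cite: NeukirchANT1999, Ch. II Prop. (5.3), (5.7)] -/
theorem torsionPExp_eq_zero_of_sq_eq_three [Fact (Nat.Prime 3)] (hf : residueDegree 3 K = 1) {ρ : K} (hρ : ρ ^ 2 = 3) :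
    torsionPExp 3 K = 0 := by
  have h3 : ‖(3 : K)‖ = 3⁻¹ := by exact_mod_cast norm_prime 3 K
  have h30 : (3 : K) ≠ 0 := fun h => by rw [h, norm_zero] at h3; norm_num at h3
  by_contra hm0
  have hm1 : 1 ≤ torsionPExp 3 K := Nat.pos_of_ne_zero hm0
  obtain ⟨ζ, hζ⟩ := exists_isPrimitiveRoot_pow_torsionPExp 3 K
  have hpow : 3 ^ torsionPExp 3 K = 3 ^ (torsionPExp 3 K - 1) * 3 := by
    rw [← pow_succ, Nat.sub_add_cancel hm1]
  have hζ3 : IsPrimitiveRoot (ζ ^ 3 ^ (torsionPExp 3 K - 1)) 3 := hζ.pow (pow_pos (by norm_num) _) hpow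
  set μ : K := ζ ^ 3 ^ (torsionPExp 3 K - 1) with hμdef
  have hμ1 : μ ≠ 1 := hζ3.ne_one (by norm_num)
  have hμ3 : μ ^ 3 = 1 := hζ3.pow_eq_one
  have hcyc : μ ^ 2 + μ + 1 = 0 := by
    have h0 : (μ - 1) * (μ ^ 2 + μ + 1) = 0 := by linear_combination hμ3
    rcases mul_eq_zero.mp h0 with h | h
    · exact absurd (sub_eq_zero.mp h) hμ1
    · exact h
  -- `u = (2μ + 1)·ρ/3` has `u² = −1`
  set u : K := (2 * μ + 1) * ρ / 3 with hudef
  have hu : u ^ 2 = -1 := by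
    have h9 : ((2 * μ + 1) * ρ) ^ 2 = -9 := by
      rw [mul_pow, hρ]; linear_combination (12 : K) * hcyc
    have h90 : (9 : K) ≠ 0 := by rw [show (9 : K) = 3 * 3 by norm_num]; exact mul_ne_zero h30 h30
    rw [hudef, div_pow, h9, show ((3 : K)) ^ 2 = 9 by norm_num, div_eq_iff h90]
    norm_num
  exact not_sq_eq_neg_one_three 3 K rfl hf hu

end LocalField

end GenuinePinsResidual

open GenuinePinsResidual

/-! ## 2. Every number field containing `√3` -/

variable {F : Type} [Field F] [NumberField F] (X : PilotData F)
  (M : Type) [Field M] [NumberField M]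
  (archPk : ∀ (j : (thetaIndex X).Label) (vQ : (thetaIndex X).VQ), Set ((logShellsDH X (analyticLogv F)).Packet j vQ))
  (archSub : ∀ (j : (thetaIndex X).Label) (v : (thetaIndex X).V),
    Set ((logShellsDH X (analyticLogv F)).Packet j ((thetaIndex X).over v)))
  (Ψ : ℤ → ∀ v : (thetaIndex X).V, v ∈ (thetaIndex X).Vbad → Set ((logShellsDH X (analyticLogv F)).StarPacket v))
  (act : ℤ → ∀ v : (thetaIndex X).V, v ∈ (thetaIndex X).Vbad →
    (logShellsDH X (analyticLogv F)).StarPacket v → Module.End ℚ ((logShellsDH X (analyticLogv F)).StarPacket v))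
  (Mmod : ℤ → ∀ j : (thetaIndex X).LabelStar, Set ((logShellsDH X (analyticLogv F)).GlobalPacket j.1))
  (region : ℤ → ∀ j : (thetaIndex X).LabelStar, FinDivisor M → ∀ vQ : (thetaIndex X).VQ,
    Set ((logShellsDH X (analyticLogv F)).Packet j.1 vQ))
  (frobAdm : ℤ → ℤ → ∀ (j : (thetaIndex X).Label) (vQ : (thetaIndex X).VQ),
    Set ((logShellsDH X (analyticLogv F)).Packet j vQ) → Prop)
  (frobLogvol : ℤ → ℤ → ∀ (j : (thetaIndex X).Label) (vQ : (thetaIndex X).VQ),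
    Set ((logShellsDH X (analyticLogv F)).Packet j vQ) → ℝ)
  (frobΨ : ℤ → ℤ → ∀ v : (thetaIndex X).V, v ∈ (thetaIndex X).Vbad → Set ((logShellsDH X (analyticLogv F)).StarPacket v))
  (frobMmod : ℤ → ℤ → ∀ j : (thetaIndex X).LabelStar, Set ((logShellsDH X (analyticLogv F)).GlobalPacket j.1))
  (unitImage : ℤ → ℤ → ℕ → ∀ (j : (thetaIndex X).Label) (vQ : (thetaIndex X).VQ),
    Set ((logShellsDH X (analyticLogv F)).Packet j vQ))
  (ballImage : ℤ → ℤ → ∀ (j : (thetaIndex X).Label) (vQ : (thetaIndex X).VQ),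
    Set ((logShellsDH X (analyticLogv F)).Packet j vQ))
  (thetaDiv : ℤ → ℤ → LgpDivisor M (thetaIndex X).lstar)
  (n : ℤ) {HT : Type} {LogLink : HT → HT → Type} {IsFull : ∀ {s t : HT}, LogLink s t → Prop}
  (lat : LGPGaussianLogThetaLattice LogLink IsFull)
  {Frd : Type} {IsoF : Frd → Frd → Type} {Ob : Frd → Type} {realify : Frd → Frd} {Strip : Type}
  {IsoS : Strip → Strip → Type} {Mv : ∀ v : (thetaIndex X).V, v ∈ (thetaIndex X).Vbad → Type}
  [∀ v h, Monoid (Mv v h)]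
  (sig : GlobalLGPFrobenioidSignature (thetaIndex X).lstar (thetaIndex X).V (· ∈ (thetaIndex X).Vbad)
    Frd IsoF Ob realify Strip IsoS Mv)
  (split : SplittingMonoids Mv) {ObΔ : Type} {N : ∀ v : (thetaIndex X).V, v ∈ (thetaIndex X).Vbad → Type}
  [∀ v h, Monoid (N v h)] (qData : QPilotData ObΔ N)
  (t : ∀ (pp : Nat.Primes) (_ : Fin X.lstar) (x : (thetaIndex X).Fibre (.inr pp)),
    haveI : Fact (pp : ℕ).Prime := ⟨pp.2⟩; kOf X pp.1 x)
  (tq : ∀ (pp : Nat.Primes) (x : (thetaIndex X).Fibre (.inr pp)), haveI : Fact (pp : ℕ).Prime := ⟨pp.2⟩; kOf X pp.1 x)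
  (ρ : (∀ v : (thetaIndex X).V, v ∈ (thetaIndex X).Vbad → Set ((logShellsDH X (analyticLogv F)).StarPacket v)) →
    ∀ (j : (thetaIndex X).Label) (vQ : (thetaIndex X).VQ), Set ((logShellsDH X (analyticLogv F)).Packet j vQ))
  (qK : ∀ v : (thetaIndex X).V, v ∈ (thetaIndex X).Vbad → Set ((logShellsDH X (analyticLogv F)).StarPacket v))
  (htq0 : ∀ pp x, tq pp x ≠ 0)
  (htq1 : ∀ (pp : Nat.Primes) (x : (thetaIndex X).Fibre (.inr pp)),
    haveI : Fact (pp : ℕ).Prime := ⟨pp.2⟩; placeOf X pp.1 x ∉ X.S → ‖tq pp x‖ = 1)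

/-- **EVERY NUMBER FIELD `F ∋ s` WITH `s² = 3` (ANY degree): `PinnedRegions` FAILS at `settingPrVolSharp`** for the analytic logarithms —
every `X : PilotData F`, `ρ`, `qK`, column data, `Ψ`, ideles, column.  At any `v₀ ∣ 3`: `e(v₀|3) ≥ 2`; if `f(v₀|3) = 1` the completion has
no `ζ_3` (§1) and p461298's torsion-free ramified feed applies (abc-iut-w5-d039's volume constraint at `m = 0`); if `f(v₀|3) ≥ 2` then
`(e, f) ≠ (2, 1)` and abc-iut-w5-d039's mover over `3` applies (p461298). [cite: DupuyHilado2025, §4.9]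
[cite: NeukirchANT1999, Ch. II Prop. (5.7), (6.8)] [claim: Mochizuki2012, status: disputed] -/
theorem not_pinnedRegions_settingPrVolSharp_of_sq_eq_three {s : F} (hs : s ^ 2 = 3) :
    ¬ Cor312Vol.PinnedRegions
      (LatticeSituation.ofShells (logShellsDH X (analyticLogv F)) M archPk archSub
        (summandPiecesPr X (logvAnalytic_analyticLogv (F := F))).Adm
        (summandPiecesPr X (logvAnalytic_analyticLogv (F := F))).logvol Ψ act Mmod region frobAdm frobLogvol frobΨ frobMmod
        unitImage ballImage thetaDiv)
      (settingPrVolSharp X (logvAnalytic_analyticLogv (F := F)) M archPk archSub Ψ act Mmod region n lat sig split qData tq t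
        htq0 htq1) ρ qK := by
  haveI : Fact (Nat.Prime 3) := ⟨Nat.prime_three⟩
  obtain ⟨v₀, hv₀mem⟩ := placesOver_nonempty F 3
  have hres : residueChar F v₀ = 3 := (mem_placesOver_iff_residueChar v₀).mp hv₀mem
  have hv₀ : (thetaIndex X).over (.inr v₀) = .inr ⟨3, Nat.prime_three⟩ := by
    rw [over_inr_eq]; exact congrArg Sum.inr (Subtype.ext hres)
  have hv : ((3 : ℕ) : 𝓞 F) ∈ v₀.asIdeal := natCast_mem_placeOf X (⟨3, Nat.prime_three⟩ : Nat.Primes) ⟨.inr v₀, hv₀⟩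
  have hs' : s ^ 2 = ((3 : ℤ) : F) := by rw [hs]; norm_num
  have he2 : 2 ≤ v₀.asIdeal.ramificationIdx ℤ :=
    two_le_ramificationIdx_of_sq_eq_of_dvd 3 v₀ hv hs' (dvd_refl _) (by norm_num)
  by_cases hf : v₀.asIdeal.inertiaDeg ℤ = 1
  · -- residue degree one: no `ζ_3` in `F_{v₀}`, torsion-free ramified feed
    set K := RescaledCompletion F 3 v₀ hv
    set r : K := RescaledCompletion.of F 3 v₀ hv (algebraMap F (v₀.adicCompletion F) s) with hrdef
    have hsq : r ^ 2 = 3 := by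
      have h : r ^ 2 = ((3 : ℤ) : K) := by rw [hrdef, ← map_pow, ← map_pow, hs', map_intCast, map_intCast]
      rw [h]; norm_num
    have hfK : residueDegree 3 K = 1 := by rw [residueDegree_rescaledCompletion F 3 v₀ hv, hf]
    have hm : torsionPExp 3 K = 0 := torsionPExp_eq_zero_of_sq_eq_three K hfK hsq
    exact not_pinnedRegions_settingPrVolSharp_of_torsionPExp_eq_zero_anyPrime X M archPk archSub Ψ act Mmod region frobAdm
      frobLogvol frobΨ frobMmod unitImage ballImage thetaDiv n lat sig split qData t tq ρ qK htq0 htq1 ⟨3, Nat.prime_three⟩ v₀ hv₀ hv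
      he2 hm
  · -- residue degree `≥ 2`: `(e, f) ≠ (2, 1)`, abc-iut-w5-d039's mover over `3`
    exact not_pinnedRegions_settingPrVolSharp_of_three_anyPrime X M archPk archSub Ψ act Mmod region frobAdm frobLogvol frobΨ
      frobMmod unitImage ballImage thetaDiv n lat sig split qData t tq ρ qK htq0 htq1 v₀ hv₀ he2 fun h => hf h.2

/-- The same for `PinnedRegions3`. [claim: Mochizuki2012, status: disputed] -/
theorem not_pinnedRegions3_settingPrVolSharp_of_sq_eq_three {s : F} (hs : s ^ 2 = 3) :
    ¬ Cor312Vol.PinnedRegions3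
      (LatticeSituation.ofShells (logShellsDH X (analyticLogv F)) M archPk archSub
        (summandPiecesPr X (logvAnalytic_analyticLogv (F := F))).Adm
        (summandPiecesPr X (logvAnalytic_analyticLogv (F := F))).logvol Ψ act Mmod region frobAdm frobLogvol frobΨ frobMmod
        unitImage ballImage thetaDiv)
      (settingPrVolSharp X (logvAnalytic_analyticLogv (F := F)) M archPk archSub Ψ act Mmod region n lat sig split qData tq t
        htq0 htq1) ρ qK :=
  fun h => not_pinnedRegions_settingPrVolSharp_of_sq_eq_three X M archPk archSub Ψ act Mmod region frobAdm frobLogvol frobΨ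
          frobMmod unitImage ballImage thetaDiv n lat sig split qData t tq ρ qK htq0 htq1 hs h.1

/-! ## 3. Every `F ∋ √d`, `d` squarefree `≠ 1` (no exception), and every `F ∋ √d`, `d ∈ ℤ` not a square -/

/-- **EVERY NUMBER FIELD `F ∋ s` WITH `s² = d`, `d` SQUAREFREE, `d ≠ 1` (ANY degree): `PinnedRegions` FAILS at `settingPrVolSharp`** for the
analytic logarithms — p462506's `…_of_sq_eq_squarefree` with its hypothesis `d ≠ 3` REMOVED (the case `d = 3` is §2).
[cite: DupuyHilado2025, §4.9] [cite: NeukirchANT1999, Ch. II Prop. (5.3), (5.7), (6.8)] [claim: Mochizuki2012, status: disputed] -/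
theorem not_pinnedRegions_settingPrVolSharp_of_sq_eq_squarefree' {s : F} {d : ℤ} (hs : s ^ 2 = d) (hsq : Squarefree d) (hd1 : d ≠ 1) :
    ¬ Cor312Vol.PinnedRegions
      (LatticeSituation.ofShells (logShellsDH X (analyticLogv F)) M archPk archSub
        (summandPiecesPr X (logvAnalytic_analyticLogv (F := F))).Adm
        (summandPiecesPr X (logvAnalytic_analyticLogv (F := F))).logvol Ψ act Mmod region frobAdm frobLogvol frobΨ frobMmod
        unitImage ballImage thetaDiv)
      (settingPrVolSharp X (logvAnalytic_analyticLogv (F := F)) M archPk archSub Ψ act Mmod region n lat sig split qData tq t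
        htq0 htq1) ρ qK := by
  by_cases hd3 : d = 3
  · subst hd3
    exact not_pinnedRegions_settingPrVolSharp_of_sq_eq_three X M archPk archSub Ψ act Mmod region frobAdm frobLogvol frobΨ
      frobMmod unitImage ballImage thetaDiv n lat sig split qData t tq ρ qK htq0 htq1 (by rw [hs]; norm_num)
  · exact not_pinnedRegions_settingPrVolSharp_of_sq_eq_squarefree X M archPk archSub Ψ act Mmod region frobAdm frobLogvol frobΨ
      frobMmod unitImage ballImage thetaDiv n lat sig split qData t tq ρ qK htq0 htq1 hs hsq hd1 hd3

/-- The same for `PinnedRegions3`. [claim: Mochizuki2012, status: disputed] -/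
theorem not_pinnedRegions3_settingPrVolSharp_of_sq_eq_squarefree' {s : F} {d : ℤ} (hs : s ^ 2 = d) (hsq : Squarefree d) (hd1 : d ≠ 1) :
    ¬ Cor312Vol.PinnedRegions3
      (LatticeSituation.ofShells (logShellsDH X (analyticLogv F)) M archPk archSub
        (summandPiecesPr X (logvAnalytic_analyticLogv (F := F))).Adm
        (summandPiecesPr X (logvAnalytic_analyticLogv (F := F))).logvol Ψ act Mmod region frobAdm frobLogvol frobΨ frobMmod
        unitImage ballImage thetaDiv)
      (settingPrVolSharp X (logvAnalytic_analyticLogv (F := F)) M archPk archSub Ψ act Mmod region n lat sig split qData tq t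
        htq0 htq1) ρ qK :=
  fun h => not_pinnedRegions_settingPrVolSharp_of_sq_eq_squarefree' X M archPk archSub Ψ act Mmod region frobAdm frobLogvol frobΨ
          frobMmod unitImage ballImage thetaDiv n lat sig split qData t tq ρ qK htq0 htq1 hs hsq hd1 h.1

/-- **EVERY NUMBER FIELD `F ∋ s` WITH `s² = d`, `d ∈ ℤ` NOT A SQUARE (ANY degree): `PinnedRegions` FAILS at `settingPrVolSharp`** for the
analytic logarithms — write `|d| = b²·a` with `a` squarefree (`Nat.sq_mul_squarefree`); then `(s/b)² = ±a` is squarefree `≠ 1` in `ℤ`, and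
the previous theorem applies. [cite: DupuyHilado2025, §4.9] [cite: NeukirchANT1999, Ch. II Prop. (5.3), (5.7), (6.8)]
[claim: Mochizuki2012, status: disputed] -/
theorem not_pinnedRegions_settingPrVolSharp_of_sq_eq_of_not_isSquare {s : F} {d : ℤ} (hs : s ^ 2 = d) (hd : ¬ IsSquare d) :
    ¬ Cor312Vol.PinnedRegions
      (LatticeSituation.ofShells (logShellsDH X (analyticLogv F)) M archPk archSub
        (summandPiecesPr X (logvAnalytic_analyticLogv (F := F))).Adm
        (summandPiecesPr X (logvAnalytic_analyticLogv (F := F))).logvol Ψ act Mmod region frobAdm frobLogvol frobΨ frobMmod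
        unitImage ballImage thetaDiv)
      (settingPrVolSharp X (logvAnalytic_analyticLogv (F := F)) M archPk archSub Ψ act Mmod region n lat sig split qData tq t
        htq0 htq1) ρ qK := by
  -- `|d| = b² · a`, `a` squarefree
  obtain ⟨a, b, hba, ha⟩ := Nat.sq_mul_squarefree d.natAbs
  have hd0 : d ≠ 0 := fun h => hd (h ▸ ⟨0, by simp⟩)
  have hb0 : b ≠ 0 := by
    rintro rfl
    apply hd0
    have : d.natAbs = 0 := by rw [← hba]; simp
    exact Int.natAbs_eq_zero.mp this
  -- the signed squarefree part `a' = sign(d) · a`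
  set a' : ℤ := d.sign * a with ha'def
  have hda' : d = (b : ℤ) ^ 2 * a' := by
    have h1 : (d.natAbs : ℤ) = (b : ℤ) ^ 2 * a := by rw [← hba]; push_cast; ring
    calc d = d.sign * (d.natAbs : ℤ) := (Int.sign_mul_natAbs d).symm
      _ = (b : ℤ) ^ 2 * a' := by rw [h1, ha'def]; ring
  have hsign : d.sign = 1 ∨ d.sign = -1 := by
    rcases lt_trichotomy d 0 with h | h | h
    · exact Or.inr (Int.sign_eq_neg_one_of_neg h)
    · exact absurd h hd0
    · exact Or.inl (Int.sign_eq_one_of_pos h)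
  have hsq' : Squarefree a' := by
    rw [← Int.squarefree_natAbs, ha'def, Int.natAbs_mul]
    rcases hsign with h | h <;> rw [h] <;> simpa using ha
  have ha1 : a' ≠ 1 := by
    intro h1
    apply hd
    exact ⟨b, by rw [hda', h1, mul_one, sq]⟩
  -- `(s / b)² = a'`
  have hbF : ((b : ℤ) : F) ≠ 0 := by exact_mod_cast hb0
  have hs' : (s / ((b : ℤ) : F)) ^ 2 = (a' : F) := by
    rw [div_pow, hs, hda']; push_cast; field_simp
  exact not_pinnedRegions_settingPrVolSharp_of_sq_eq_squarefree' X M archPk archSub Ψ act Mmod region frobAdm frobLogvol frobΨ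
    frobMmod unitImage ballImage thetaDiv n lat sig split qData t tq ρ qK htq0 htq1 hs' hsq' ha1

/-- The same for `PinnedRegions3`. [claim: Mochizuki2012, status: disputed] -/
theorem not_pinnedRegions3_settingPrVolSharp_of_sq_eq_of_not_isSquare {s : F} {d : ℤ} (hs : s ^ 2 = d) (hd : ¬ IsSquare d) :
    ¬ Cor312Vol.PinnedRegions3
      (LatticeSituation.ofShells (logShellsDH X (analyticLogv F)) M archPk archSub
        (summandPiecesPr X (logvAnalytic_analyticLogv (F := F))).Adm
        (summandPiecesPr X (logvAnalytic_analyticLogv (F := F))).logvol Ψ act Mmod region frobAdm frobLogvol frobΨ frobMmod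
        unitImage ballImage thetaDiv)
      (settingPrVolSharp X (logvAnalytic_analyticLogv (F := F)) M archPk archSub Ψ act Mmod region n lat sig split qData tq t
        htq0 htq1) ρ qK :=
  fun h => not_pinnedRegions_settingPrVolSharp_of_sq_eq_of_not_isSquare X M archPk archSub Ψ act Mmod region frobAdm frobLogvol frobΨ
          frobMmod unitImage ballImage thetaDiv n lat sig split qData t tq ρ qK htq0 htq1 hs hd h.1

/-! ## 4. Every number field with a quadratic subfield -/

/-- **EVERY NUMBER FIELD WITH A QUADRATIC SUBFIELD `K ≤ F`: `PinnedRegions` FAILS at `settingPrVolSharp`** for the analytic logarithms —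
every `X : PilotData F`, `ρ`, `qK`, column data, `Ψ`, ideles, column.  `K = ℚ(√d_K)` with `d_K` a fundamental discriminant (tree:
`Quadratic.exists_sq_eq_discr`, `Quadratic.isFundamentalDiscriminant_discr` — Marcus, *Number Fields*, Ch. 2 Thm. 1), so `F ∋ √d` with `d`
squarefree `≠ 1` (`d = d_K` or `d_K/4`), and §3 applies; the degree of `F` never enters.
[cite: DupuyHilado2025, §4.9] [cite: NeukirchANT1999, Ch. II Prop. (5.3), (5.7), (6.8)] [claim: Mochizuki2012, status: disputed] -/
theorem not_pinnedRegions_settingPrVolSharp_of_intermediateField_finrank_eq_two (K : IntermediateField ℚ F)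
    (hK : Module.finrank ℚ K = 2) :
    ¬ Cor312Vol.PinnedRegions
      (LatticeSituation.ofShells (logShellsDH X (analyticLogv F)) M archPk archSub
        (summandPiecesPr X (logvAnalytic_analyticLogv (F := F))).Adm
        (summandPiecesPr X (logvAnalytic_analyticLogv (F := F))).logvol Ψ act Mmod region frobAdm frobLogvol frobΨ frobMmod
        unitImage ballImage thetaDiv)
      (settingPrVolSharp X (logvAnalytic_analyticLogv (F := F)) M archPk archSub Ψ act Mmod region n lat sig split qData tq t
        htq0 htq1) ρ qK := by
  haveI : CharZero K := charZero_of_injective_algebraMap (algebraMap ℚ K).injective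
  haveI : NumberField K := NumberField.mk
  obtain ⟨-, -, δ, -, hδ⟩ := Quadratic.exists_sq_eq_discr (K := K) hK
  -- `√d_K ∈ F`
  set s : F := ((δ : K) : F) with hsdef
  have hδK : ((δ : K)) ^ 2 = ((NumberField.discr K : ℤ) : K) := by
    have h := congrArg (algebraMap (𝓞 K) K) hδ
    rwa [map_pow, map_intCast] at h
  have hsF : s ^ 2 = ((NumberField.discr K : ℤ) : F) := by
    have h := congrArg (algebraMap K F) hδK
    rw [map_pow, map_intCast] at h
    exact h
  rcases Quadratic.isFundamentalDiscriminant_discr (K := K) hK with ⟨-, hsq, hne⟩ | ⟨h4, hm, hsq⟩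
  · exact not_pinnedRegions_settingPrVolSharp_of_sq_eq_squarefree' X M archPk archSub Ψ act Mmod region frobAdm frobLogvol frobΨ
          frobMmod unitImage ballImage thetaDiv n lat sig split qData t tq ρ qK htq0 htq1 hsF hsq hne
  · -- `d_K = 4m`: `F ∋ s/2` with `(s/2)² = m`, `m ≡ 2, 3 (mod 4)` squarefree, `m ≠ 1`
    set m : ℤ := NumberField.discr K / 4 with hmdef
    have hDm : NumberField.discr K = 4 * m := by rw [hmdef]; exact (Int.mul_ediv_cancel' h4).symm
    have h20 : (2 : F) ≠ 0 := two_ne_zero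
    have hs2 : (s / 2) ^ 2 = (m : F) := by
      rw [div_pow, hsF, hDm]; push_cast; field_simp; ring
    exact not_pinnedRegions_settingPrVolSharp_of_sq_eq_squarefree' X M archPk archSub Ψ act Mmod region frobAdm frobLogvol frobΨ
          frobMmod unitImage ballImage thetaDiv n lat sig split qData t tq ρ qK htq0 htq1 hs2 hsq (by omega)

/-- The same for `PinnedRegions3`. [claim: Mochizuki2012, status: disputed] -/
theorem not_pinnedRegions3_settingPrVolSharp_of_intermediateField_finrank_eq_two (K : IntermediateField ℚ F)
    (hK : Module.finrank ℚ K = 2) :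
    ¬ Cor312Vol.PinnedRegions3
      (LatticeSituation.ofShells (logShellsDH X (analyticLogv F)) M archPk archSub
        (summandPiecesPr X (logvAnalytic_analyticLogv (F := F))).Adm
        (summandPiecesPr X (logvAnalytic_analyticLogv (F := F))).logvol Ψ act Mmod region frobAdm frobLogvol frobΨ frobMmod
        unitImage ballImage thetaDiv)
      (settingPrVolSharp X (logvAnalytic_analyticLogv (F := F)) M archPk archSub Ψ act Mmod region n lat sig split qData tq t
        htq0 htq1) ρ qK :=
  fun h => not_pinnedRegions_settingPrVolSharp_of_intermediateField_finrank_eq_two X M archPk archSub Ψ act Mmod region frobAdm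
          frobLogvol frobΨ frobMmod unitImage ballImage thetaDiv n lat sig split qData t tq ρ qK htq0 htq1 K hK h.1

end Summit.ABC.IUTFork.Joshi

end
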